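import Summits.QuantumFields.YangMills.Theorems.FluctuationComparisonRegPrIntLLargeFieldGasBlockAnimals
import Literature.Probability.LatticeModels.ClusterExpansionKPBound
import HarnessLib

/-!
# LFG^{can}∘ — THE VACUUM ROW (vKP) OF THE TWO-GAS PACKAGE FROM A BLOCK-DECAY MAJORANT (G16, px10 lineage): ★★ `vKP_of_blockDecay` — on the `μ`-blocks of any torus of the tree's
# `Setup`, activities vanishing at `∅` and off the footprints of touching-connected block families, with `|v X| ≤ E₀·e^{−κ_v·#blocks X}`, satisfy the Kotecký–Preiss row (1) of
# ✓`enginePackage_of_twoGasPackage` ∕ ✓`engineRows_of_twoGas` — `Σ_{γ′ : polyInc γ′ σ} |v γ′|·e^{τ·#blocks γ′ + κ′·#blocks γ′} ≤ τ·#blocks σ` — as soon as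
# `τ + κ′ + 2 + 2·log(3^d − 1) ≤ κ_v` and the pin `E₀·(d·L^{dμ}) ≤ τ`

Cell `ym3-torus` (HUMAN RULING D-0037: rung R3 = continuum `SU(2)` Yang–Mills on `T³` — NOT `d = 4`, NOT infinite volume, NOT a mass gap, NOT the Clay problem); width seat
`ym3-torus-px10` (gen 18); helper of the crux `stmt-QuantumFields-20520` `UnitScaleTilt.FluctuationComparisonRegPrIntL` (`--supports … --as helper`, NOT a proof of it).
THEOREMS ONLY: 0 `def`, 0 `instance`, 0 `notation`, 0 `sorry`, default heartbeats.  The sibling of ✓p794678 FILE 12 `kpGasOn_of_blockDecay` (which serves the GAS lane's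
`KPGasOn` clauses): here the output is the (a, d)-form row `a = τ·#blocks`, `d = κ′·#blocks` that the TWO-GAS PACKAGE (FILE E `…LargeFieldGasOfTwoGasPackage`, row (vKP)) asks of
the vacuum activities at each field `U` of the window — print's (1.97)∕(1.100): activities on unions of big cubes with tree decay per cube.
* §1 `card_le_mul_card_image_blk` — a bond set has at most `d·L^{dμ}·#blocks` bonds (✓FILE 7 `card_cell_le`); `exists_mem_inter_of_polyInc` — a non-empty polymer incompatible
  with `σ` shares a bond with `σ`.
* §2 ★★ `vKP_of_blockDecay` — the row, by `Σ_{γ′ ι σ} ≤ Σ_{b∈σ} Σ_{γ′ ∋ b}` (lit `sum_biUnion_le_sum_of_nonneg`), the block-animal entropy ✓p800212 `sum_exp_neg_blocks_le_one` at rate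
  `κ_v − τ − κ′`, and the pin.

HONEST SCOPE.  Lattice bookkeeping; the block-decay majorant `|v_U X| ≤ E₀e^{−κ_v·#blocks}` IS the analytic content of the vacuum gas ([Balaban1985UV3] §B propagator decay,
[Balaban1987RG1] (0.22)–(0.25)) and stays a hypothesis; currency caveat №229 (V-locality) untouched; LF-INT∘ ∕ `stub_largeFieldFourPtIntCan` ∕ S2β ∕ 20520 NOT proved; `YM3TorusSU2`
NOT proved; rung R3 = YM₃ on `T³` — NOT `d = 4`, NOT infinite volume, NOT a mass gap, NOT Clay.
References: [Balaban1989LargeFieldII] T. Bałaban, CMP 122 (1989) (1.97)–(1.101) pp.389–390; [Balaban1987RG1] CMP 109 (1987) (0.22)–(0.25) pp.256–257; [KoteckyPreiss1986] CMP 103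
(1986), (1) p.492.
-/

set_option autoImplicit false

noncomputable section

open Finset
open scoped BigOperators
open Literature.Probability.LatticeModels (polyInc sum_biUnion_le_sum_of_nonneg)
open Literature.MathematicalPhysics.QuantumFieldTheory.Balaban1983to89
open Literature.MathematicalPhysics.QuantumFieldTheory.Balaban1983to89.Node00 (touchingGraph SiteTouch)
open Literature.MathematicalPhysics.QuantumFieldTheory.Balaban1983to89.B5Eq118OneStroke (iterBlockOf)
open Summit.QuantumFields.YangMills.Theorems.FluctuationComparisonRegPrIntLLargeFieldGasFootprint (mem_biUnion_cell_iff card_image_blk_biUnion_cell card_cell_le)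
open Summit.QuantumFields.YangMills.Theorems.FluctuationComparisonRegPrIntLLargeFieldGasBlockAnimals (sum_exp_neg_blocks_le_one)

namespace Summit.QuantumFields.YangMills.Theorems.FluctuationComparisonRegPrIntLLargeFieldGasVacuumKPOfBlockDecay

variable {P : Params} {μ : ℕ}

/-! ## §1 Bookkeeping -/

open Classical in
/-- A bond set has at most `d·L^{dμ}` bonds per block it meets: `|σ| ≤ (d·L^{dμ})·#blocks(σ)`. [cite: Balaban1989LargeFieldII, (1.84) p.386 (bookkeeping)] -/
theorem card_le_mul_card_image_blk (hμ : μ ≤ P.m + P.K) (σ : Finset (PBond P 0)) :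
    (σ.card : ℝ) ≤ ((P.d * (P.L ^ P.d) ^ μ : ℕ) : ℝ) * (((σ.image (fun b : PBond P 0 => iterBlockOf μ b.src)).card : ℕ) : ℝ) := by
  have hsub : σ ⊆ (σ.image (fun b : PBond P 0 => iterBlockOf μ b.src)).biUnion
      (fun y => Finset.univ.filter (fun b : PBond P 0 => iterBlockOf μ b.src = y)) := by
    intro b hb
    rw [mem_biUnion_cell_iff]
    exact Finset.mem_image_of_mem _ hb
  have h1 : σ.card ≤ (σ.image (fun b : PBond P 0 => iterBlockOf μ b.src)).card * (P.d * (P.L ^ P.d) ^ μ) :=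
    (Finset.card_le_card hsub).trans (Finset.card_biUnion_le.trans
      ((Finset.sum_le_sum fun y _ => card_cell_le hμ y).trans (by rw [Finset.sum_const, smul_eq_mul])))
  calc (σ.card : ℝ) ≤ (((σ.image (fun b : PBond P 0 => iterBlockOf μ b.src)).card * (P.d * (P.L ^ P.d) ^ μ) : ℕ) : ℝ) := by exact_mod_cast h1
    _ = ((P.d * (P.L ^ P.d) ^ μ : ℕ) : ℝ) * (((σ.image (fun b : PBond P 0 => iterBlockOf μ b.src)).card : ℕ) : ℝ) := by push_cast; ring

/-- A non-empty polymer incompatible (`polyInc` = equal or meeting) with `σ` shares a bond with `σ`. [cite: KoteckyPreiss1986, §2 (the incompatibility ι)] -/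
theorem exists_mem_inter_of_polyInc {γ σ : Finset (PBond P 0)} (hne : γ.Nonempty) (h : polyInc γ σ) : ∃ b ∈ σ, b ∈ γ := by
  rcases h with h | ⟨b, hb⟩
  · subst h; obtain ⟨b, hb⟩ := hne; exact ⟨b, hb, hb⟩
  · exact ⟨b, (Finset.mem_inter.1 hb).2, (Finset.mem_inter.1 hb).1⟩

/-! ## §2 The vacuum row from a block-decay majorant -/

open Classical in
/-- ★★ **Row (vKP) of the TWO-GAS PACKAGE from a block-decay majorant.**  Activities `v` on bond sets of a torus (`d ≥ 1`, grain `μ ≤ m + K`) with `v ∅ = 0`, vanishing off the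
footprints of touching-connected block families, and `|v X| ≤ E₀·e^{−κ_v·#blocks X}` (`0 ≤ E₀`); rate `τ + κ′ + (2 + 2·log(3^d − 1)) ≤ κ_v`; pin
`E₀·(d·L^{dμ}) ≤ τ`.  THEN the Kotecký–Preiss row (1) with size `τ·#blocks` and decay `κ′·#blocks`:
`Σ_{γ′ : polyInc γ′ σ} |v γ′|·e^{τ·#blocks γ′ + κ′·#blocks γ′} ≤ τ·#blocks σ` for every `σ`. [cite: Balaban1989LargeFieldII, (1.97) p.389 and (1.100)-(1.101) p.390; KoteckyPreiss1986, (1) p.492] -/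
theorem vKP_of_blockDecay (hd : 0 < P.d) (hμ : μ ≤ P.m + P.K) (v : Finset (PBond P 0) → ℝ) {E₀ κv τ κ' : ℝ} (hE₀ : 0 ≤ E₀)
    (h0 : v ∅ = 0)
    (hsupp : ∀ X : Finset (PBond P 0), v X ≠ 0 → ∃ Fc : Finset (Site P μ),
      ((touchingGraph (SiteTouch (P := P) (j := μ))).induce (Fc : Set (Site P μ))).Connected ∧
        Fc.biUnion (fun y => Finset.univ.filter (fun b : PBond P 0 => iterBlockOf μ b.src = y)) = X)
    (hbd : ∀ X : Finset (PBond P 0), |v X| ≤ E₀ * Real.exp (-(κv * (((X.image (fun b : PBond P 0 => iterBlockOf μ b.src)).card : ℕ) : ℝ))))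
    (hrate : τ + κ' + (2 + 2 * Real.log ((3 ^ P.d - 1 : ℕ) : ℝ)) ≤ κv) (hpin : E₀ * ((P.d * (P.L ^ P.d) ^ μ : ℕ) : ℝ) ≤ τ) (σ : Finset (PBond P 0)) :
    ∑ γ' ∈ Finset.univ.filter (fun γ' : Finset (PBond P 0) => polyInc γ' σ),
      |v γ'| * Real.exp (τ * (((γ'.image (fun b : PBond P 0 => iterBlockOf μ b.src)).card : ℕ) : ℝ) +
        κ' * (((γ'.image (fun b : PBond P 0 => iterBlockOf μ b.src)).card : ℕ) : ℝ)) ≤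
      τ * (((σ.image (fun b : PBond P 0 => iterBlockOf μ b.src)).card : ℕ) : ℝ) := by
  -- abbreviations
  set n : Finset (PBond P 0) → ℝ := fun X => (((X.image (fun b : PBond P 0 => iterBlockOf μ b.src)).card : ℕ) : ℝ) with hn
  set f : Finset (PBond P 0) → ℝ := fun γ' => |v γ'| * Real.exp (τ * n γ' + κ' * n γ') with hf
  have hf0 : ∀ γ', 0 ≤ f γ' := fun γ' => mul_nonneg (abs_nonneg _) (Real.exp_nonneg _)
  set Foot : Finset (PBond P 0) → Prop := fun X => ∃ Fc : Finset (Site P μ),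
      ((touchingGraph (SiteTouch (P := P) (j := μ))).induce (Fc : Set (Site P μ))).Connected ∧
        Fc.biUnion (fun y => Finset.univ.filter (fun b : PBond P 0 => iterBlockOf μ b.src = y)) = X with hFoot
  -- the non-zero terms touch `σ` at a bond and are footprints
  have hsub : ∀ γ' ∈ Finset.univ.filter (fun γ' : Finset (PBond P 0) => polyInc γ' σ), f γ' ≠ 0 →
      γ' ∈ σ.biUnion (fun b => Finset.univ.filter (fun X : Finset (PBond P 0) => b ∈ X ∧ Foot X)) := by
    intro γ' hγ' hfγ
    have hv : v γ' ≠ 0 := by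
      intro h; apply hfγ; simp [hf, h]
    have hne : γ'.Nonempty := by
      rw [Finset.nonempty_iff_ne_empty]; rintro rfl; exact hv h0
    obtain ⟨b, hbσ, hbγ⟩ := exists_mem_inter_of_polyInc hne (Finset.mem_filter.1 hγ').2
    exact Finset.mem_biUnion.2 ⟨b, hbσ, Finset.mem_filter.2 ⟨Finset.mem_univ _, hbγ, hsupp γ' hv⟩⟩
  -- Σ_{γ′ ι σ} f ≤ Σ_{b∈σ} Σ_{γ′ ∋ b, footprint} f
  have step1 : ∑ γ' ∈ Finset.univ.filter (fun γ' : Finset (PBond P 0) => polyInc γ' σ), f γ' ≤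
      ∑ b ∈ σ, ∑ γ' ∈ Finset.univ.filter (fun X : Finset (PBond P 0) => b ∈ X ∧ Foot X), f γ' := by
    calc ∑ γ' ∈ Finset.univ.filter (fun γ' : Finset (PBond P 0) => polyInc γ' σ), f γ'
        = ∑ γ' ∈ (Finset.univ.filter (fun γ' : Finset (PBond P 0) => polyInc γ' σ)).filter (fun γ' => f γ' ≠ 0), f γ' := by
          rw [Finset.sum_filter_ne_zero]
      _ ≤ ∑ γ' ∈ σ.biUnion (fun b => Finset.univ.filter (fun X : Finset (PBond P 0) => b ∈ X ∧ Foot X)), f γ' :=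
          Finset.sum_le_sum_of_subset_of_nonneg (fun γ' hγ' => hsub γ' (Finset.mem_filter.1 hγ').1 (Finset.mem_filter.1 hγ').2) fun γ' _ _ => hf0 γ'
      _ ≤ ∑ b ∈ σ, ∑ γ' ∈ Finset.univ.filter (fun X : Finset (PBond P 0) => b ∈ X ∧ Foot X), f γ' := sum_biUnion_le_sum_of_nonneg σ _ f hf0
  -- each inner sum ≤ E₀ (block decay beats the weights, then the block-animal entropy)
  have hκe : 2 + 2 * Real.log ((3 ^ P.d - 1 : ℕ) : ℝ) ≤ κv - τ - κ' := by linarith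
  have step2 : ∀ b : PBond P 0, ∑ γ' ∈ Finset.univ.filter (fun X : Finset (PBond P 0) => b ∈ X ∧ Foot X), f γ' ≤ E₀ := by
    intro b
    have hent := sum_exp_neg_blocks_le_one (μ := μ) hd hμ hκe b
    calc ∑ γ' ∈ Finset.univ.filter (fun X : Finset (PBond P 0) => b ∈ X ∧ Foot X), f γ'
        ≤ ∑ γ' ∈ Finset.univ.filter (fun X : Finset (PBond P 0) => b ∈ X ∧ Foot X), E₀ * Real.exp (-((κv - τ - κ') * n γ')) := by
          refine Finset.sum_le_sum fun γ' _ => ?_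
          calc f γ' ≤ E₀ * Real.exp (-(κv * n γ')) * Real.exp (τ * n γ' + κ' * n γ') :=
                mul_le_mul_of_nonneg_right (hbd γ') (Real.exp_nonneg _)
            _ = E₀ * Real.exp (-((κv - τ - κ') * n γ')) := by rw [mul_assoc, ← Real.exp_add]; ring_nf
      _ = E₀ * ∑ γ' ∈ Finset.univ.filter (fun X : Finset (PBond P 0) => b ∈ X ∧ Foot X), Real.exp (-((κv - τ - κ') * n γ')) := by
          rw [Finset.mul_sum]
      _ ≤ E₀ * 1 := mul_le_mul_of_nonneg_left (by simpa [hn, hFoot] using hent) hE₀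
      _ = E₀ := mul_one _
  -- assemble: ≤ |σ|·E₀ ≤ (s₀·#blocks σ)·E₀ ≤ τ·#blocks σ
  calc ∑ γ' ∈ Finset.univ.filter (fun γ' : Finset (PBond P 0) => polyInc γ' σ), f γ'
      ≤ ∑ b ∈ σ, ∑ γ' ∈ Finset.univ.filter (fun X : Finset (PBond P 0) => b ∈ X ∧ Foot X), f γ' := step1
    _ ≤ ∑ _b ∈ σ, E₀ := Finset.sum_le_sum fun b _ => step2 b
    _ = (σ.card : ℝ) * E₀ := by rw [Finset.sum_const, nsmul_eq_mul]
    _ ≤ (((P.d * (P.L ^ P.d) ^ μ : ℕ) : ℝ) * n σ) * E₀ := mul_le_mul_of_nonneg_right (card_le_mul_card_image_blk hμ σ) hE₀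
    _ = (E₀ * ((P.d * (P.L ^ P.d) ^ μ : ℕ) : ℝ)) * n σ := by ring
    _ ≤ τ * n σ := mul_le_mul_of_nonneg_right hpin (Nat.cast_nonneg _)

end Summit.QuantumFields.YangMills.Theorems.FluctuationComparisonRegPrIntLLargeFieldGasVacuumKPOfBlockDecay

end
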